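import Summits.KontsevichZagierPeriods.KontsevichZagierPeriods.Theorems.HurwitzMicroSectorsNormalFormPrincipleLevelOne
import Summits.KontsevichZagierPeriods.KontsevichZagierPeriods.Theorems.HurwitzMicroSectorsNormalFormPrincipleSlabASubPtK20
import Summits.KontsevichZagierPeriods.KontsevichZagierPeriods.Theorems.HurwitzMicroSectorsNormalFormPrincipleAlgCarriers
import Summits.KontsevichZagierPeriods.KontsevichZagierPeriods.Theorems.HurwitzMicroSectorsNormalFormPrincipleM2FiveZetaTwo

/-!
# `NormalFormPrinciple` (stmt-KontsevichZagierPeriods-3869), line `SketchIdeator1` — leaf `stub_boxRigidity`: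
# all weights, level `K`, totally off resonance: the merge `t = Π x_l` in dimension `n + 1` (rule 2)

Pure proof file (`--supports` the crux). Registered sub-goal `mergeN` of the layer "Conjecture 1
for the boxes `[(0,1)^{n+1}, c (Π_l x_l^{e_l})/(1 − Π_l x_l^K)]` totally off resonance" (lead file
`…WeightN`), for a level `K ≥ 1`, a real-algebraic coefficient `c` and exponents with
`e (last n) < e (castSucc i)` for all `i`: the box representation
`N = [(0,1)^{n+1}, c (Π_l x_l^{e_l})/(1 − Π_l x_l^K)]` and the band representation
`R = [{y ∈ (0,1)ⁿ, 0 ≤ t ≤ Π_i y_i}, c (Π_i y_i^{e_i − e_last − 1}) t^{e_last}/(1 − t^K)]` differ by a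
relation. For `n ≥ 1`, `N` is congruent (rule 1: the two null faces `x_last ∈ {0, 1}`,
`KZ.IntegralRep.of_sub_of_restrict_mem_relations`, `KZ.of_sub_of_mem_relations_of_eqOn`) to the
same integrand on the band-box `(0,1)ⁿ × [0,1]` (where `1 − Π_l x_l^K = 1 − (Π_l x_l)^K > 0`), which
the substitution `t = (Π_i y_i)·x_last` along the last coordinate over the OPEN base `(0,1)ⁿ`
(`KZ.of_sub_of_mem_relations_of_affine`, `α = 0`, `β = Π_i y_i > 0`, Jacobian `Π_i y_i`) carries
onto `R`:
`c (Π_i y_i^{e_i−e_last−1}) ((Π_i y_i) x_last)^{e_last}/(1 − ((Π_i y_i) x_last)^K) · Π_i y_i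
  = c (Π_l x_l^{e_l})/(1 − Π_l x_l^K)`.
For `n = 0` the two domains `(0,1) ⊆ [0,1]` differ by a null set and the integrands agree (rule 1).
Port, to all dimensions, of `…PiBox.Weight3.w3_merge_box_sub_band`.
References: M. Kontsevich, D. Zagier, *Periods* (2001), §1.2 rules (1), (2). No new definitions.
-/

noncomputable section

open MeasureTheory Set
open Literature.NumberTheory.Transcendental Literature.NumberTheory.Transcendental.KZ
open Literature.ModelTheory.ExponentialFields (IsSemialgebraic)

namespace Summit.KontsevichZagierPeriods.HurwitzMicroSectors.NormalFormPrinciple.PiBox.WeightN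

/-- The dimension-`n + 1` level-`K` merge identity
`c (Π_i y_i^{E_i}) t^D/(1 − (Π_i y_i^K) t^K)
  = c (Π_i y_i^{E_i−D−1}) ((Π_i y_i) t)^D/(1 − ((Π_i y_i) t)^K) · Π_i y_i` for `D < E_i`
(`E_i = (E_i − D − 1) + D + 1`, `((Π_i y_i) t)^K = (Π_i y_i^K) t^K`). [folklore] -/
theorem wn_merge_identity {n : ℕ} (K D : ℕ) (E : Fin n → ℕ) (hE : ∀ i, D < E i) (c t : ℝ)
    (y : Fin n → ℝ) :
    c * ((∏ i, y i ^ (E i)) * t ^ D) / (1 - (∏ i, y i ^ K) * t ^ K) =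
      c * (∏ i, y i ^ (E i - D - 1)) * ((∏ i, y i) * t) ^ D / (1 - ((∏ i, y i) * t) ^ K) *
        ∏ i, y i := by
  have hprod : (∏ i, y i ^ (E i - D - 1)) * (∏ i, y i) ^ D * ∏ i, y i = ∏ i, y i ^ (E i) := by
    rw [← Finset.prod_pow, ← Finset.prod_mul_distrib, ← Finset.prod_mul_distrib]
    refine Finset.prod_congr rfl fun i _ => ?_
    rw [← pow_add, ← pow_succ]
    congr 1
    have := hE i
    omega
  rw [mul_pow, mul_pow, Finset.prod_pow, ← hprod]
  ring

/-- A product of numbers in `[0,1]`, one of which is `< 1`, is `< 1`. [folklore] -/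
theorem wn_merge_prod_lt_one {m : ℕ} {x : Fin m → ℝ} (h0 : ∀ l, 0 ≤ x l) (h1 : ∀ l, x l ≤ 1)
    (l₀ : Fin m) (hl₀ : x l₀ < 1) : ∏ l, x l < 1 := by
  rw [← Finset.mul_prod_erase Finset.univ x (Finset.mem_univ l₀)]
  exact mul_lt_one_of_nonneg_of_lt_one_left (h0 l₀) hl₀
    (Finset.prod_le_one (fun l _ => h0 l) fun l _ => h1 l)

/-- On the band-box `(0,1)ⁿ × [0,1]`, `n ≥ 1`, the level-`K` denominator is positive for `K ≠ 0`:
`0 < 1 − Π_l x_l^K` (since `Π_l x_l^K = (Π_l x_l)^K` and `0 ≤ Π_l x_l ≤ x_0 < 1`). [folklore] -/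
theorem wn_merge_denom_pos {n K : ℕ} (hK : K ≠ 0) (hn : 0 < n) {x : Fin (n + 1) → ℝ}
    (h : (∀ i : Fin n, 0 < x (Fin.castSucc i) ∧ x (Fin.castSucc i) < 1) ∧
      0 ≤ x (Fin.last n) ∧ x (Fin.last n) ≤ 1) :
    0 < 1 - ∏ l, x l ^ K := by
  obtain ⟨hc, hl0, hl1⟩ := h
  have h0 : ∀ l, 0 ≤ x l := fun l => by
    induction l using Fin.lastCases with
    | last => exact hl0
    | cast i => exact (hc i).1.le
  have h1 : ∀ l, x l ≤ 1 := fun l => by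
    induction l using Fin.lastCases with
    | last => exact hl1
    | cast i => exact (hc i).2.le
  have hlt : ∏ l, x l < 1 :=
    wn_merge_prod_lt_one h0 h1 (Fin.castSucc ⟨0, hn⟩) (hc ⟨0, hn⟩).2
  rw [Finset.prod_pow]
  exact sub_pos.2 (pow_lt_one₀ (Finset.prod_nonneg fun l _ => h0 l) hlt hK)

/-- The integrand `c (Π_l x_l^{e_l})/(1 − Π_l x_l^K)` (`K ≠ 0`, `n ≥ 1`) with a real-algebraic
coefficient `c` is `ℚ`-semialgebraic on the band-box `(0,1)ⁿ × [0,1]` (where its denominator is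
positive): the product of the `ℚ`-definable constant `c` and a quotient of polynomials over `ℚ`.
[cite: KontsevichZagier2001, §1.1] -/
theorem wn_merge_isSemialgebraicFunOn_boxIntegrand {n K : ℕ} (hK : K ≠ 0) (hn : 0 < n)
    (e : Fin (n + 1) → ℕ) {c : ℝ} (hc : IsAlgebraic ℚ c)
    (hB : IsSemialgebraic ℚ (KZlog.band {y : Fin n → ℝ | ∀ i, y i ∈ Set.Ioo (0:ℝ) 1}
      (fun _ => (0:ℝ)) (fun _ => (1:ℝ)))) :
    IsSemialgebraicFunOn ℚ
      (KZlog.band {y : Fin n → ℝ | ∀ i, y i ∈ Set.Ioo (0:ℝ) 1} (fun _ => (0:ℝ)) (fun _ => (1:ℝ)))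
      (fun x => c * (∏ l, x l ^ (e l)) / (1 - ∏ l, x l ^ K)) := by
  have hq : ∀ x ∈ KZlog.band {y : Fin n → ℝ | ∀ i, y i ∈ Set.Ioo (0:ℝ) 1} (fun _ => (0:ℝ))
      (fun _ => (1:ℝ)),
      MvPolynomial.aeval x (1 - ∏ l, MvPolynomial.X l ^ K : MvPolynomial (Fin (n + 1)) ℚ) ≠ 0 := by
    intro x hx
    simp only [map_sub, map_one, map_prod, map_pow, MvPolynomial.aeval_X]
    exact (wn_merge_denom_pos hK hn ⟨hx.1, hx.2.1, hx.2.2⟩).ne'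
  refine (IsSemialgebraicFunOn.mul_holds (isSemialgebraicFunOn_const_of_isAlgebraic hB hc)
    (isSemialgebraicFunOn_aeval_div_aeval hB (∏ l, MvPolynomial.X l ^ (e l))
      (1 - ∏ l, MvPolynomial.X l ^ K) hq)).congr fun x _ => ?_
  simp only [Pi.mul_apply, map_sub, map_one, map_prod, map_pow, MvPolynomial.aeval_X]
  ring

/-- **The merge in dimension `0 + 1` (degenerate case, rule 1).** For `n = 0` the base `(0,1)⁰`
is a point, the band `{0 ≤ t ≤ Π_{i<0} y_i = 1}` is `[0,1] ⊇ (0,1)` and the two integrands agree on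
`(0,1)`; the difference `{0, 1}` of the domains is null, so `[N] − [R]` is a relation
(`KZ.IntegralRep.of_sub_of_restrict_mem_relations`, `KZ.of_sub_of_mem_relations_of_eqOn`).
[cite: KontsevichZagier2001, §1.2 rule (1)] -/
theorem wn_merge_zero (n : ℕ) (hn : n = 0) (K : ℕ) (e : Fin (n + 1) → ℕ) (c : ℝ)
    (N R : IntegralRep (n + 1))
    (hNd : N.domain = {x | ∀ i, x i ∈ Set.Ioo (0:ℝ) 1})
    (hNi : EqOn N.integrand (fun x => c * (∏ l, x l ^ (e l)) / (1 - ∏ l, x l ^ K)) N.domain)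
    (hRd : R.domain = KZlog.band {y : Fin n → ℝ | ∀ i, y i ∈ Set.Ioo (0:ℝ) 1} (fun _ => (0:ℝ))
      (fun y => ∏ i, y i))
    (hRi : EqOn R.integrand (fun z => c * (∏ i : Fin n, z (Fin.castSucc i) ^
        (e (Fin.castSucc i) - e (Fin.last n) - 1)) * z (Fin.last n) ^ (e (Fin.last n)) /
        (1 - z (Fin.last n) ^ K)) R.domain) :
    of N - of R ∈ relations := by
  subst hn
  have hone : ∀ z : Fin (0 + 1) → ℝ, ∏ i : Fin 0, Fin.init z i = 1 := fun z => by
    rw [Finset.univ_eq_empty, Finset.prod_empty]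
  have hEr : N.domain ⊆ R.domain := by
    intro z hz
    rw [hNd, Set.mem_setOf_eq] at hz
    rw [hRd]
    refine ⟨fun i => i.elim0, (hz (Fin.last 0)).1.le, ?_⟩
    show z (Fin.last 0) ≤ ∏ i : Fin 0, Fin.init z i
    rw [hone]
    exact (hz (Fin.last 0)).2.le
  have hsub : R.domain ⊆ N.domain ∪ ({z | z (Fin.last 0) = 0} ∪ {z | z (Fin.last 0) = 1}) := by
    intro z hz
    rw [hRd] at hz
    obtain ⟨-, h0, h1⟩ := hz
    have h1' : z (Fin.last 0) ≤ 1 := by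
      have h1'' : z (Fin.last 0) ≤ ∏ i : Fin 0, Fin.init z i := h1
      rwa [hone] at h1''
    have h0' : 0 ≤ z (Fin.last 0) := h0
    rcases h0'.eq_or_lt with h0' | h0'
    · exact Or.inr (Or.inl h0'.symm)
    rcases h1'.lt_or_eq with h1' | h1'
    · refine Or.inl ?_
      rw [hNd, Set.mem_setOf_eq]
      intro i
      induction i using Fin.lastCases with
      | last => exact ⟨h0', h1'⟩
      | cast j => exact j.elim0
    · exact Or.inr (Or.inr h1')
  have hnull : volume (R.domain \ N.domain) = 0 := by
    refine measure_mono_null (fun z hz => ?_)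
      (measure_union_null (volume_setOf_last_eq_zero (n := 0) 0)
        (volume_setOf_last_eq_zero (n := 0) 1))
    rcases hsub hz.1 with h | h
    · exact absurd h hz.2
    · exact h
  have e1 : of R - of (R.restrict N.domain N.isSemialgebraic_domain hEr) ∈ relations :=
    R.of_sub_of_restrict_mem_relations N.isSemialgebraic_domain hEr hnull
  have e2 : of N - of (R.restrict N.domain N.isSemialgebraic_domain hEr) ∈ relations := by
    refine of_sub_of_mem_relations_of_eqOn rfl fun z hz => ?_
    rw [IntegralRep.integrand_restrict, hNi hz, hRi (hEr hz)]
    simp only [Fin.prod_univ_castSucc, Finset.univ_eq_empty, Finset.prod_empty, one_mul, mul_one]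
  have e : of N - of R = (of N - of (R.restrict N.domain N.isSemialgebraic_domain hEr)) -
      (of R - of (R.restrict N.domain N.isSemialgebraic_domain hEr)) := by
    abel
  rw [e]
  exact relations.sub_mem e2 e1

/-- **The merge `t = Π_l x_l` in dimension `n + 1`, `n ≥ 1`, with a real-algebraic coefficient**
(Kontsevich–Zagier rules 1, 2). For `0 < K`, `e (last n) < e (castSucc i)` for all `i` and `c`
real algebraic, the box representation `N = [(0,1)^{n+1}, c (Π_l x_l^{e_l})/(1 − Π_l x_l^K)]` and
the band representation
`R = [{y ∈ (0,1)ⁿ, 0 ≤ t ≤ Π_i y_i}, c (Π_i y_i^{e_i−e_last−1}) t^{e_last}/(1 − t^K)]` differ by a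
relation: `N` is congruent (rule 1, the two null faces `x_last ∈ {0,1}`) to the same integrand on
the band-box `(0,1)ⁿ × [0,1]`, which the substitution `t = (Π_i y_i)·x_last` along the last
coordinate (`KZ.of_sub_of_mem_relations_of_affine` over the open base `(0,1)ⁿ`, `α = 0`,
`β = Π_i y_i`, Jacobian `Π_i y_i`) carries onto `R`.
[cite: KontsevichZagier2001, §1.2 rules (1), (2)] -/
theorem wn_merge_pos (n : ℕ) (hn : 0 < n) (K : ℕ) (hK : 0 < K) (e : Fin (n + 1) → ℕ)
    (he : ∀ i : Fin n, e (Fin.last n) < e (Fin.castSucc i)) (c : ℝ) (hc : IsAlgebraic ℚ c)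
    (N R : IntegralRep (n + 1))
    (hNd : N.domain = {x | ∀ i, x i ∈ Set.Ioo (0:ℝ) 1})
    (hNi : EqOn N.integrand (fun x => c * (∏ l, x l ^ (e l)) / (1 - ∏ l, x l ^ K)) N.domain)
    (hRd : R.domain = KZlog.band {y : Fin n → ℝ | ∀ i, y i ∈ Set.Ioo (0:ℝ) 1} (fun _ => (0:ℝ))
      (fun y => ∏ i, y i))
    (hRi : EqOn R.integrand (fun z => c * (∏ i : Fin n, z (Fin.castSucc i) ^
        (e (Fin.castSucc i) - e (Fin.last n) - 1)) * z (Fin.last n) ^ (e (Fin.last n)) /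
        (1 - z (Fin.last n) ^ K)) R.domain) :
    of N - of R ∈ relations := by
  have hK0 : K ≠ 0 := Nat.pos_iff_ne_zero.1 hK
  -- the open base `G = (0,1)ⁿ` and the band-box `B₀ = G × [0,1]` over it
  have hG : IsSemialgebraic ℚ {y : Fin n → ℝ | ∀ i, y i ∈ Set.Ioo (0:ℝ) 1} :=
    isSemialgebraic_box n
  have hGo : IsOpen {y : Fin n → ℝ | ∀ i, y i ∈ Set.Ioo (0:ℝ) 1} := by
    rw [Set.setOf_forall]
    exact isOpen_iInter_of_finite fun i => isOpen_Ioo.preimage (continuous_apply i)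
  have hα : IsSemialgebraicFunOn ℚ {y : Fin n → ℝ | ∀ i, y i ∈ Set.Ioo (0:ℝ) 1}
      (fun _ => (0:ℝ)) := by
    simpa using isSemialgebraicFunOn_ratCast hG 0
  have hone : IsSemialgebraicFunOn ℚ {y : Fin n → ℝ | ∀ i, y i ∈ Set.Ioo (0:ℝ) 1}
      (fun _ => (1:ℝ)) := by
    simpa using isSemialgebraicFunOn_ratCast hG 1
  have hβ : IsSemialgebraicFunOn ℚ {y : Fin n → ℝ | ∀ i, y i ∈ Set.Ioo (0:ℝ) 1}
      (fun y => ∏ i, y i) :=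
    (isSemialgebraicFunOn_aeval hG (∏ i, MvPolynomial.X i)).congr fun y _ => by
      simp only [map_prod, MvPolynomial.aeval_X]
  have hβd : DifferentiableOn ℝ (fun y : Fin n → ℝ => ∏ i, y i)
      {y : Fin n → ℝ | ∀ i, y i ∈ Set.Ioo (0:ℝ) 1} := fun y _ =>
    (hasFDerivAt_finsetProd (𝕜 := ℝ) (u := Finset.univ)
      (x := y)).differentiableAt.differentiableWithinAt
  have hβpos : ∀ y ∈ {y : Fin n → ℝ | ∀ i, y i ∈ Set.Ioo (0:ℝ) 1}, 0 < ∏ i, y i :=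
    fun y hy => Finset.prod_pos fun i _ => (hy i).1
  have hB : IsSemialgebraic ℚ (KZlog.band {y : Fin n → ℝ | ∀ i, y i ∈ Set.Ioo (0:ℝ) 1}
      (fun _ => (0:ℝ)) (fun _ => (1:ℝ))) :=
    KZlog.isSemialgebraic_band hα hone
  -- coordinates of a point of the band-box: `z (castSucc i) ∈ (0,1)`, `z (last n) ∈ [0,1]`
  have hmemB : ∀ z ∈ KZlog.band {y : Fin n → ℝ | ∀ i, y i ∈ Set.Ioo (0:ℝ) 1}
      (fun _ => (0:ℝ)) (fun _ => (1:ℝ)),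
      (∀ i : Fin n, 0 < z (Fin.castSucc i) ∧ z (Fin.castSucc i) < 1) ∧
        0 ≤ z (Fin.last n) ∧ z (Fin.last n) ≤ 1 :=
    fun z hz => ⟨hz.1, hz.2.1, hz.2.2⟩
  -- the explicit box integrand is semialgebraic on the band-box ...
  have hsa := wn_merge_isSemialgebraicFunOn_boxIntegrand hK0 hn e hc hB
  -- ... and integrable there: the band-box is the open box plus two null faces
  have hNint : IntegrableOn (fun x : Fin (n + 1) → ℝ => c * (∏ l, x l ^ (e l)) /
      (1 - ∏ l, x l ^ K)) N.domain :=
    N.integrableOn.congr_fun hNi (IntegralRep.measurableSet_domain_holds N)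
  have hsub : KZlog.band {y : Fin n → ℝ | ∀ i, y i ∈ Set.Ioo (0:ℝ) 1} (fun _ => (0:ℝ))
      (fun _ => (1:ℝ)) ⊆
      N.domain ∪ ({z | z (Fin.last n) = 0} ∪ {z | z (Fin.last n) = 1}) := by
    intro z hz
    obtain ⟨hcs, h0, h1⟩ := hmemB z hz
    rcases h0.eq_or_lt with h0 | h0
    · exact Or.inr (Or.inl h0.symm)
    rcases h1.lt_or_eq with h1 | h1
    · refine Or.inl ?_
      rw [hNd, Set.mem_setOf_eq]
      intro i
      induction i using Fin.lastCases with
      | last => exact ⟨h0, h1⟩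
      | cast j => exact hcs j
    · exact Or.inr (Or.inr h1)
  have hint : IntegrableOn (fun x : Fin (n + 1) → ℝ => c * (∏ l, x l ^ (e l)) /
      (1 - ∏ l, x l ^ K))
      (KZlog.band {y : Fin n → ℝ | ∀ i, y i ∈ Set.Ioo (0:ℝ) 1} (fun _ => (0:ℝ))
        (fun _ => (1:ℝ))) :=
    (hNint.union ((IntegrableOn.of_measure_zero (volume_setOf_last_eq_zero 0)).union
      (IntegrableOn.of_measure_zero (volume_setOf_last_eq_zero 1)))).mono_set hsub
  -- the representation `r = [B₀, c (Π_l x_l^{e_l})/(1 − Π_l x_l^K)]`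
  obtain ⟨r, hrd, hri⟩ : ∃ r : IntegralRep (n + 1),
      r.domain = KZlog.band {y : Fin n → ℝ | ∀ i, y i ∈ Set.Ioo (0:ℝ) 1} (fun _ => (0:ℝ))
        (fun _ => (1:ℝ)) ∧
      r.integrand = fun x => c * (∏ l, x l ^ (e l)) / (1 - ∏ l, x l ^ K) :=
    ⟨⟨_, _, hB, hsa, hint⟩, rfl, rfl⟩
  -- (rule 1) `N` versus `r`: restriction to the open box and congruence
  have hEr : N.domain ⊆ r.domain := by
    intro z hz
    rw [hNd, Set.mem_setOf_eq] at hz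
    rw [hrd]
    exact ⟨fun i => hz (Fin.castSucc i), (hz (Fin.last n)).1.le, (hz (Fin.last n)).2.le⟩
  have hnull : volume (r.domain \ N.domain) = 0 := by
    refine measure_mono_null (fun z hz => ?_)
      (measure_union_null (volume_setOf_last_eq_zero (n := n) 0)
        (volume_setOf_last_eq_zero (n := n) 1))
    rcases hsub (hrd ▸ hz.1) with h | h
    · exact absurd h hz.2
    · exact h
  have e1 : of r - of (r.restrict N.domain N.isSemialgebraic_domain hEr) ∈ relations :=
    r.of_sub_of_restrict_mem_relations N.isSemialgebraic_domain hEr hnull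
  have e2 : of N - of (r.restrict N.domain N.isSemialgebraic_domain hEr) ∈ relations :=
    of_sub_of_mem_relations_of_eqOn rfl (by rw [IntegralRep.integrand_restrict, hri]; exact hNi)
  -- (rule 2) `r` versus `R`: the substitution `t = (Π_i y_i) · x_last` along the last coordinate
  have hinit : ∀ (z : Fin (n + 1) → ℝ) (i : Fin n), Fin.init z i = z (Fin.castSucc i) :=
    fun z i => rfl
  have key : ∀ z ∈ r.domain, r.integrand z =
      R.integrand (Fin.snoc (Fin.init z) (0 + (∏ i, Fin.init z i) * z (Fin.last n))) *
        ∏ i, Fin.init z i := by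
    intro z hz
    rw [hrd] at hz
    obtain ⟨hcs, h0, h1⟩ := hmemB z hz
    have hp : 0 ≤ ∏ i, Fin.init z i := Finset.prod_nonneg fun i _ => (hcs i).1.le
    have hw : (Fin.snoc (Fin.init z) (0 + (∏ i, Fin.init z i) * z (Fin.last n)) :
        Fin (n + 1) → ℝ) ∈ R.domain := by
      rw [hRd]
      refine KZlog.mem_band.2 ?_
      rw [Fin.init_snoc, Fin.snoc_last]
      refine ⟨hz.1, ?_, ?_⟩
      · show (0:ℝ) ≤ 0 + (∏ i, Fin.init z i) * z (Fin.last n)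
        rw [zero_add]
        exact mul_nonneg hp h0
      · show 0 + (∏ i, Fin.init z i) * z (Fin.last n) ≤ ∏ i, Fin.init z i
        rw [zero_add]
        exact mul_le_of_le_one_right hp h1
    rw [hRi hw, hri]
    simp only [Fin.snoc_castSucc, Fin.snoc_last, zero_add, hinit]
    rw [Fin.prod_univ_castSucc, Fin.prod_univ_castSucc]
    exact wn_merge_identity K (e (Fin.last n)) (fun i => e (Fin.castSucc i)) he c
      (z (Fin.last n)) (fun i => z (Fin.castSucc i))
  have e3 : of r - of R ∈ relations :=
    of_sub_of_mem_relations_of_affine (m := n) hGo (α := fun _ => (0:ℝ))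
      (β := fun y => ∏ i, y i) (a := fun _ => (0:ℝ)) (b := fun _ => (1:ℝ))
      (a' := fun _ => (0:ℝ)) (b' := fun y => ∏ i, y i) hα hβ (differentiableOn_const 0) hβd
      hβpos r R hrd hRd (fun y _ => by ring) (fun y _ => by ring) key
  -- bookkeeping
  have e : of N - of R = (of N - of (r.restrict N.domain N.isSemialgebraic_domain hEr)) -
      (of r - of (r.restrict N.domain N.isSemialgebraic_domain hEr)) + (of r - of R) := by
    abel
  rw [e]
  exact relations.add_mem (relations.sub_mem e2 e1) e3

/-- **Stub N3 (merge `t = Π x_l` in dimension `n + 1`, rule 2, affine in the last coordinate).**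
For a level `K ≥ 1`, a real-algebraic coefficient `c` and exponents `e : Fin (n+1) → ℕ` with
`e (last n) < e (castSucc i)` for all `i`, the box representation
`[(0,1)^{n+1}, c (Π_l x_l^{e_l})/(1 − Π_l x_l^K)]` and the band representation
`R_n(e ∘ castSucc − e(last) − 1; e(last)) =
  [{y ∈ (0,1)ⁿ, 0 ≤ t ≤ Π_i y_i}, c (Π_i y_i^{e_i − e_last − 1}) t^{e_last}/(1 − t^K)]`
differ by a KZ relation (null faces, rule 1, then the merge substitution `t = Π_l x_l` along the
last coordinate, rule 2: `(Π_i y_i^K) (t/Π_i y_i)^K = t^K`; the case `n = 0` is a null-set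
congruence). [cite: KontsevichZagier2001, §1.2 rules (1), (2)] -/
theorem mergeN (n : ℕ) (K : ℕ) (hK : 0 < K) (e : Fin (n + 1) → ℕ)
    (he : ∀ i : Fin n, e (Fin.last n) < e (Fin.castSucc i)) (c : ℝ) (hc : IsAlgebraic ℚ c)
    (N R : IntegralRep (n + 1))
    (hNd : N.domain = {x | ∀ i, x i ∈ Set.Ioo (0:ℝ) 1})
    (hNi : EqOn N.integrand (fun x => c * (∏ l, x l ^ (e l)) / (1 - ∏ l, x l ^ K)) N.domain)
    (hRd : R.domain = KZlog.band {y : Fin n → ℝ | ∀ i, y i ∈ Set.Ioo (0:ℝ) 1} (fun _ => (0:ℝ))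
      (fun y => ∏ i, y i))
    (hRi : EqOn R.integrand (fun z => c * (∏ i : Fin n, z (Fin.castSucc i) ^
        (e (Fin.castSucc i) - e (Fin.last n) - 1)) * z (Fin.last n) ^ (e (Fin.last n)) /
        (1 - z (Fin.last n) ^ K)) R.domain) :
    of N - of R ∈ relations := by
  rcases Nat.eq_zero_or_pos n with hn | hn
  · exact wn_merge_zero n hn K e c N R hNd hNi hRd hRi
  · exact wn_merge_pos n hn K hK e he c hc N R hNd hNi hRd hRi

end Summit.KontsevichZagierPeriods.HurwitzMicroSectors.NormalFormPrinciple.PiBox.WeightN
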